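import Literature.Analysis.FluidPDE.PassiveVectorTensorGalerkinSmoothWeakForm
import Literature.Analysis.FluidPDE.PassiveVectorGalerkinSolution
import HarnessLib

/-!
# The Fourier–Galerkin scheme with a smooth carrier, V: passage to the limit; the weak solution

Analysis/FluidPDE proof-support file (theorems only; no named facts), sequel of `PassiveVectorTensorGalerkinSmoothWeakForm`,
ported from `PassiveVectorGalerkinExistence` / `PassiveVectorGalerkinSolution` (Robinson–Rodrigo–Sadowski 2016, Thm. 4.4
Step 4: the Galerkin identities pass to the limit `N → ∞`). For the data `Torus.PVSSetup 𝔸 lo hi b M G w₀` (constant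
tensor `𝔸` with Legendre–Hadamard constants `NearIso 𝔸 lo hi`, `lo ≥ 0`; a smooth carrier `Torus.SmoothCarrier b M G`;
an `L²` weakly divergence-free datum) and a Galerkin limit `w` (`Torus.PVSSetup.IsGalerkinLimit`):

* the tested Galerkin terms are continuous in time (`PVSSetup.continuousOn_galerkinTested`), the truncation inside the
  transport term costs `M · O(lattice tail)` uniformly on `[0,T] × T^d`, the slices converge weakly in `L²`
  (`IsGalerkinLimit.slice_props`), and dominated convergence in time gives **the weak formulation of the limit** with
  the viscous term `𝓛^*_{𝔸ᵀ}` (`IsGalerkinLimit.weak_eq`);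
* with the bookkeeping of the class (`b` bounded and jointly continuous, `w ∈ L^∞_t L²_x`) the limit is a weak solution
  **`Torus.IsWeakTensorPassiveVectorOn 0 T (majorTranspose 𝔸) b w₀ w` for every `T > 0`**
  (`IsGalerkinLimit.isWeakTensorPassiveVectorOn`), with `∫‖w t‖² ≤ ∫‖w₀‖²` for `t ≥ 0` (`PVSSetup.exists_weak_solution`).

## References

* J. C. Robinson, J. L. Rodrigo, W. Sadowski, *The three-dimensional Navier–Stokes equations* (CUP 2016), Thm. 4.4
  Step 4, (4.5), Thm. 4.6, Lemma 2.9. [`RobinsonRodrigoSadowski2016`]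
* R. J. DiPerna, P.-L. Lions, Invent. Math. 98 (1989) 511–547, §II.1 (12)–(14). [`DiPernaLions1989`]
* U. Frisch, *Turbulence* (CUP 1995), §9.6.3 eq. (9.57). [`Frisch1995Turbulence`]
-/

open MeasureTheory Set Filter Topology UnitAddTorus Metric Function
open scoped ENNReal NNReal InnerProductSpace

noncomputable section

namespace Literature.Analysis.FluidPDE

namespace Torus

open FunctionSpaces.Torus FunctionSpaces

variable {d : Type*} [Fintype d] [DecidableEq d]

/-! ## The carrier: the bookkeeping clauses -/

section Carrier

variable {b : ℝ → UnitAddTorus d → EuclideanSpace ℝ d} {M G : ℝ}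

/-- A smooth carrier lies in `L^∞((0,T) × T^d)` (through its space–time lift). [cite: DiPernaLions1989, §II.1 (12)–(14)] -/
theorem SmoothCarrier.memLp_top_stLift (hb : SmoothCarrier b M G) (T : ℝ) :
    MemLp (stLift b) ∞ (volume.restrict (Ioo 0 T ×ˢ (univ : Set (EuclideanSpace ℝ d)))) :=
  memLp_top_of_bound hb.continuous_stLift.aestronglyMeasurable M
    (ae_of_all _ fun p => hb.norm_le p.1 (proj p.2))

/-- Every slice of a smooth carrier has `∫⁻ ‖b t‖ₑ² ≤ M²`. [cite: DiPernaLions1989, §II.1 (12)–(14)] -/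
theorem SmoothCarrier.lintegral_enorm_sq_le (hb : SmoothCarrier b M G) (t : ℝ) :
    ∫⁻ x, ‖b t x‖ₑ ^ 2 ≤ ENNReal.ofReal (M ^ 2) := by
  calc ∫⁻ x, ‖b t x‖ₑ ^ 2 ≤ ∫⁻ _ : UnitAddTorus d, ENNReal.ofReal (M ^ 2) := by
        refine lintegral_mono fun x => ?_
        rw [← ofReal_norm, ← ENNReal.ofReal_pow (norm_nonneg _)]
        exact ENNReal.ofReal_le_ofReal (pow_le_pow_left₀ (norm_nonneg _) (hb.norm_le t x) 2)
    _ = ENNReal.ofReal (M ^ 2) := by rw [lintegral_const, measure_univ, mul_one]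

/-- **`b ∈ L¹(0,T; L²)`** for a smooth carrier (bounded). [cite: DiPernaLions1989, §II.1 (12)–(14)] -/
theorem SmoothCarrier.lintegral_carrier_lt_top (hb : SmoothCarrier b M G) (T : ℝ) :
    ∫⁻ t in Ioo 0 T, (∫⁻ x, ‖b t x‖ₑ ^ 2) ^ (1 / 2 : ℝ) < ∞ := by
  calc ∫⁻ t in Ioo 0 T, (∫⁻ x, ‖b t x‖ₑ ^ 2) ^ (1 / 2 : ℝ)
      ≤ ∫⁻ _ in Ioo 0 T, (ENNReal.ofReal (M ^ 2)) ^ (1 / 2 : ℝ) :=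
        lintegral_mono fun t => ENNReal.rpow_le_rpow (hb.lintegral_enorm_sq_le t) (by norm_num)
    _ < ∞ := by
        rw [setLIntegral_const]
        exact ENNReal.mul_lt_top (ENNReal.rpow_lt_top_of_nonneg (by norm_num) ENNReal.ofReal_ne_top) measure_Ioo_lt_top

/-- **The tested field `∂ₜΨ + (b·∇)(P_N Ψ) + 𝓛_𝔹^* Ψ` has a continuous space–time lift** (jointly continuous carrier,
`∂ᵢ P_N Ψ = P_N ∂ᵢ Ψ` with coefficients continuous in time). [cite: RobinsonRodrigoSadowski2016, Thm. 4.4 Step 4 (4.5)] -/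
theorem SmoothCarrier.continuous_stLift_tested (hb : SmoothCarrier b M G) {T : ℝ}
    {Ψ : ℝ → UnitAddTorus d → EuclideanSpace ℝ d} (hΨ : IsSpaceTimeTest T Ψ) (𝔹 : Visc4 d) (N : ℕ) :
    Continuous (stLift fun t x => FunctionSpaces.Torus.timeDeriv Ψ t x +
      FunctionSpaces.Torus.convect (b t) (fourierTruncate N (Ψ t)) x + viscAdj 𝔹 (Ψ t) x) := by
  have hD : ∀ i, Continuous (stLift fun t x => fourierTruncate N (FunctionSpaces.Torus.partialDeriv i (Ψ t)) x) := by
    intro i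
    refine continuous_stLift_fourierTruncate (fun k => ?_) N
    rw [← continuousOn_univ]
    exact continuousOn_mFourierCoeff_of_continuousOn_stLift
      (hΨ.isSmoothSpaceTimeOn_partialDeriv i).continuous_stLift_of_univ.continuousOn k
  have hV : Continuous (stLift fun t => viscAdj 𝔹 (Ψ t)) := (isSpaceTimeTest_viscAdj 𝔹 hΨ).1.continuous
  have e : (stLift fun t x => FunctionSpaces.Torus.timeDeriv Ψ t x +
      FunctionSpaces.Torus.convect (b t) (fourierTruncate N (Ψ t)) x + viscAdj 𝔹 (Ψ t) x) =
      fun q => stLift (FunctionSpaces.Torus.timeDeriv Ψ) q +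
        ∑ i, (stLift b q) i • stLift (fun t x => fourierTruncate N (FunctionSpaces.Torus.partialDeriv i (Ψ t)) x) q +
        stLift (fun t => viscAdj 𝔹 (Ψ t)) q := by
    funext q
    obtain ⟨t, y⟩ := q
    simp only [stLift_apply, FunctionSpaces.Torus.convect]
    rw [fderiv_apply_eq_sum_partialDeriv ((isSmooth_fourierTruncate N (Ψ t)).isContDiff (by simp))]
    congr 2
    refine Finset.sum_congr rfl fun i _ => ?_
    rw [partialDeriv_fourierTruncate (hΨ.isSmooth_slice t)]
  rw [e]
  exact (hΨ.timeDeriv.1.continuous.add (continuous_finsetSum _ fun i _ =>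
    ((EuclideanSpace.proj (𝕜 := ℝ) i).continuous.comp hb.continuous_stLift).smul (hD i))).add hV

end Carrier

/-! ## Continuity in time of the tested Galerkin terms -/

section Continuity

variable {𝔸 : Visc4 d} {lo hi : ℝ} {b : ℝ → UnitAddTorus d → EuclideanSpace ℝ d} {M G : ℝ}
  {w₀ : UnitAddTorus d → EuclideanSpace ℝ d}

/-- The extended Galerkin coefficients of the smooth-carrier scheme are continuous on `[0, ∞)`. [cite: RobinsonRodrigoSadowski2016, Thm. 4.4 Step 1 (4.5)] -/
theorem PVSSetup.continuousOn_galerkinCoeffAt (h : PVSSetup 𝔸 lo hi b M G w₀) (N : ℕ) (k : d → ℤ) :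
    ContinuousOn (fun t => h.galerkinCoeffAt N t k) (Ici 0) := by
  by_cases hk : k ∈ freqBall N
  · have e : (fun t => h.galerkinCoeffAt N t k) = fun t => h.galerkinCoeff N t ⟨k, hk⟩ := by
      funext t; rw [PVSSetup.galerkinCoeffAt, coeffExt_of_mem _ hk]
    rw [e]
    exact (continuous_apply _).comp_continuousOn (h.galerkinCoeff_spec N).2.2.1
  · have e : (fun t => h.galerkinCoeffAt N t k) = fun _ => 0 := by
      funext t; rw [PVSSetup.galerkinCoeffAt, coeffExt_of_not_mem _ hk]
    rw [e]
    exact continuousOn_const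

/-- The space–time lift of the Galerkin approximation is continuous on `[0, ∞) × ℝ^d`. [cite: RobinsonRodrigoSadowski2016, Thm. 4.4 Step 1 (4.3)] -/
theorem PVSSetup.continuousOn_stLift_galerkinApprox (h : PVSSetup 𝔸 lo hi b M G w₀) (N : ℕ) :
    ContinuousOn (stLift (h.galerkinApprox N)) (Ici 0 ×ˢ (univ : Set (EuclideanSpace ℝ d))) := by
  have e : stLift (h.galerkinApprox N) = fun q : ℝ × EuclideanSpace ℝ d =>
      ∑ k ∈ freqBall N, EuclideanSpace.realPart (mFourier k (proj q.2) • h.galerkinCoeffAt N q.1 k) := by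
    funext q
    obtain ⟨t, y⟩ := q
    rw [stLift_apply, PVSSetup.galerkinApprox, realTrigPoly_apply_eq_sum]
  rw [e]
  refine continuousOn_finsetSum _ fun k _ => EuclideanSpace.realPart.continuous.comp_continuousOn ?_
  exact (((mFourier k).continuous.comp (continuous_proj.comp continuous_snd)).continuousOn).smul
    ((h.continuousOn_galerkinCoeffAt N k).comp continuous_fst.continuousOn fun q hq => (mem_prod.1 hq).1)

/-- **The tested Galerkin term is continuous in time** on `[0, ∞)`:
`t ↦ ∫⟪u_N(t), ∂ₜΨ(t) + (b(t)·∇)(P_N Ψ(t)) + 𝓛_𝔹^*Ψ(t)⟫`. [cite: RobinsonRodrigoSadowski2016, Thm. 4.4 Step 4 (4.5)] -/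
theorem PVSSetup.continuousOn_galerkinTested (h : PVSSetup 𝔸 lo hi b M G w₀) {T : ℝ}
    {Ψ : ℝ → UnitAddTorus d → EuclideanSpace ℝ d} (hΨ : IsSpaceTimeTest T Ψ) (𝔹 : Visc4 d) (N : ℕ) :
    ContinuousOn (fun t => ∫ x, ⟪h.galerkinApprox N t x, FunctionSpaces.Torus.timeDeriv Ψ t x +
        FunctionSpaces.Torus.convect (b t) (fourierTruncate N (Ψ t)) x + viscAdj 𝔹 (Ψ t) x⟫_ℝ) (Ici 0) := by
  refine continuousOn_integral_of_continuousOn_stLift ?_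
  have e : (stLift fun t x => ⟪h.galerkinApprox N t x, FunctionSpaces.Torus.timeDeriv Ψ t x +
      FunctionSpaces.Torus.convect (b t) (fourierTruncate N (Ψ t)) x + viscAdj 𝔹 (Ψ t) x⟫_ℝ) =
      fun q => ⟪stLift (h.galerkinApprox N) q, stLift (fun t x => FunctionSpaces.Torus.timeDeriv Ψ t x +
        FunctionSpaces.Torus.convect (b t) (fourierTruncate N (Ψ t)) x + viscAdj 𝔹 (Ψ t) x) q⟫_ℝ := by
    funext q
    obtain ⟨t, y⟩ := q
    rfl
  rw [e]
  exact (h.continuousOn_stLift_galerkinApprox N).inner (h.carrier.continuous_stLift_tested hΨ 𝔹 N).continuousOn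

end Continuity

/-! ## The weak formulation of the Galerkin limit -/

section WeakForm

variable {𝔸 : Visc4 d} {lo hi : ℝ} {b : ℝ → UnitAddTorus d → EuclideanSpace ℝ d} {M G : ℝ}
  {w₀ : UnitAddTorus d → EuclideanSpace ℝ d}
  {h : PVSSetup 𝔸 lo hi b M G w₀} {φ : ℕ → ℕ} {c : ℝ → (d → ℤ) → EuclideanSpace ℂ d}
  {w : ℝ → UnitAddTorus d → EuclideanSpace ℝ d}

omit [Fintype d] [DecidableEq d] in
/-- `|⟪u, v⟫| ≤ L (‖u‖² + 1)/2` when `‖v‖ ≤ L`, `L ≥ 0`. [folklore] -/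
private theorem abs_inner_le_half_of_norm_le' {E : Type*} [NormedAddCommGroup E] [InnerProductSpace ℝ E] (u v : E)
    {L : ℝ} (hL : 0 ≤ L) (hv : ‖v‖ ≤ L) : |⟪u, v⟫_ℝ| ≤ L / 2 * ‖u‖ ^ 2 + L / 2 := by
  refine (abs_real_inner_le_norm u v).trans ?_
  have h1 : ‖u‖ * ‖v‖ ≤ ‖u‖ * L := mul_le_mul_of_nonneg_left hv (norm_nonneg _)
  nlinarith [sq_nonneg (‖u‖ - 1), norm_nonneg u, h1]

omit [DecidableEq d] in
/-- `|∫⟪u, v⟫| ≤ L (∫‖u‖² + 1)/2` for `‖v‖ ≤ L` pointwise and `u ∈ L²`. [folklore] -/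
private theorem abs_integral_inner_le_half_of_norm_le' {u v : UnitAddTorus d → EuclideanSpace ℝ d}
    (hu : MemLp u 2 volume) {L : ℝ} (hL : 0 ≤ L) (hvL : ∀ x, ‖v x‖ ≤ L) :
    |∫ x, ⟪u x, v x⟫_ℝ| ≤ L / 2 * (∫ x, ‖u x‖ ^ 2) + L / 2 := by
  have iu : Integrable (fun x => ‖u x‖ ^ 2) volume := hu.integrable_norm_pow two_ne_zero
  have i1 : Integrable (fun x => L / 2 * ‖u x‖ ^ 2 + L / 2) volume := (iu.const_mul _).add (integrable_const _)
  calc |∫ x, ⟪u x, v x⟫_ℝ| ≤ ∫ x, |⟪u x, v x⟫_ℝ| := abs_integral_le_integral_abs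
    _ ≤ ∫ x, (L / 2 * ‖u x‖ ^ 2 + L / 2) :=
        integral_mono_of_nonneg (ae_of_all _ fun x => abs_nonneg _) i1
          (ae_of_all _ fun x => abs_inner_le_half_of_norm_le' _ _ hL (hvL x))
    _ = L / 2 * (∫ x, ‖u x‖ ^ 2) + L / 2 := by
        rw [integral_add (iu.const_mul _) (integrable_const _), integral_const_mul, integral_const]
        simp [Measure.real]

/-- **The weak formulation of a Galerkin limit of the smooth-carrier tensor scheme** (Robinson–Rodrigo–Sadowski 2016,
Thm. 4.4 Step 4, linear terms): for every `T > 0` and every divergence-free space–time test field `Ψ` on `[0, T)`,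
`∫_{(0,T)} ∫ (⟪w, ∂ₜΨ + (b·∇)Ψ + 𝓛^*_{𝔸ᵀ}Ψ⟫ + 0·⟪b, (w·∇)Ψ⟫) + ∫⟪w₀, Ψ(0)⟫ = 0`.
The Galerkin identities `PVSSetup.galerkin_weak_identity` pass to the limit along the subsequence: the truncation inside
the transport term costs `M · O(lattice tail)` uniformly (`norm_convect_fourierTruncate_sub_le`,
`exists_sum_norm_partialDeriv_sub_fourierTruncate_le`), the slices converge weakly in `L²` (`IsGalerkinLimit.slice_props`),
the tested terms are uniformly bounded, and dominated convergence in time applies; the datum term by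
`tendsto_integral_inner_fourierTruncate_left_subseq`. [cite: RobinsonRodrigoSadowski2016, Thm. 4.4 Step 4] -/
theorem PVSSetup.IsGalerkinLimit.weak_eq (hl : h.IsGalerkinLimit φ c w) {T : ℝ} (hT : 0 < T)
    {Ψ : ℝ → UnitAddTorus d → EuclideanSpace ℝ d} (hΨ : IsSpaceTimeTest T Ψ) (hΨdiv : ∀ t, IsDivFree (Ψ t)) :
    (∫ t in Ioo 0 T, ∫ x, (⟪w t x, FunctionSpaces.Torus.timeDeriv Ψ t x + FunctionSpaces.Torus.convect (b t) (Ψ t) x +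
        viscAdj (majorTranspose 𝔸) (Ψ t) x⟫_ℝ + 0 * ⟪b t x, FunctionSpaces.Torus.convect (w t) (Ψ t) x⟫_ℝ)) +
      ∫ x, ⟪w₀ x, Ψ 0 x⟫_ℝ = 0 := by
  have hb := h.carrier
  simp only [zero_mul, add_zero]
  -- notation
  set u : ℕ → ℝ → UnitAddTorus d → EuclideanSpace ℝ d := fun n => h.galerkinApprox (φ n) with hu
  set Gn : ℕ → ℝ → UnitAddTorus d → EuclideanSpace ℝ d := fun n t x =>
    FunctionSpaces.Torus.timeDeriv Ψ t x + FunctionSpaces.Torus.convect (b t) (fourierTruncate (φ n) (Ψ t)) x +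
      viscAdj (majorTranspose 𝔸) (Ψ t) x with hGn
  set g : ℝ → UnitAddTorus d → EuclideanSpace ℝ d := fun t x =>
    FunctionSpaces.Torus.timeDeriv Ψ t x + FunctionSpaces.Torus.convect (b t) (Ψ t) x +
      viscAdj (majorTranspose 𝔸) (Ψ t) x with hg
  set Fn : ℕ → ℝ → ℝ := fun n t => ∫ x, ⟪u n t x, Gn n t x⟫_ℝ with hFn
  set Fl : ℝ → ℝ := fun t => ∫ x, ⟪w t x, g t x⟫_ℝ with hFl
  -- tails
  set τ : ℕ → ℝ := fun N => ∑' k : {k // k ∉ freqBall (d := d) N},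
    ((1 + freqNormSq (k : d → ℤ)) ^ Fintype.card d)⁻¹ with hτ
  have hτ0 : Tendsto τ atTop (𝓝 0) := tendsto_tsum_compl_freqBall_inv_pow
  have hτφ : Tendsto (fun n => τ (φ n)) atTop (𝓝 0) := hτ0.comp hl.strictMono.tendsto_atTop
  have hτnn : ∀ N, 0 ≤ τ N := fun N => tsum_nonneg fun k => by
    have := freqNormSq_nonneg (k : d → ℤ)
    positivity
  -- Step 1: the Galerkin identities
  have hID : ∀ᶠ n in atTop, (∫ t in Ioo 0 T, Fn n t) + ∫ x, ⟪fourierTruncate (φ n) w₀ x, Ψ 0 x⟫_ℝ = 0 :=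
    Eventually.of_forall fun n => h.galerkin_weak_identity (φ n) hT hΨ hΨdiv
  -- Step 2: uniform data on `[0, T] × T^d`
  obtain ⟨Kp, -, -, Cd, hCd0, hKp, -, -, hCd⟩ := hΨ.exists_bounds
  obtain ⟨-, -, Kv, -, -, -, -, hKv, -⟩ := (isSpaceTimeTest_viscAdj (majorTranspose 𝔸) hΨ).exists_bounds
  obtain ⟨K₃, hK₃0, hK₃⟩ := exists_sum_norm_partialDeriv_sub_fourierTruncate_le hΨ T
  have hM0 : 0 ≤ M := hb.nonneg
  have hbx : ∀ t x, ‖b t x‖ ≤ M := hb.norm_le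
  set E : ℝ := ∫ x, ‖w₀ x‖ ^ 2 with hE
  have hE0 : 0 ≤ E := integral_nonneg fun x => by positivity
  have huE : ∀ n t, 0 ≤ t → ∫ x, ‖u n t x‖ ^ 2 ≤ E := fun n t ht => h.integral_norm_sq_galerkinApprox_le (φ n) ht
  have hum : ∀ n t, MemLp (u n t) 2 volume := fun n t => memLp_realTrigPoly _ _ 2
  have hKp0 : 0 ≤ Kp := (norm_nonneg _).trans (hKp 0 ⟨le_rfl, hT.le⟩ 0)
  have hKv0 : 0 ≤ Kv := (norm_nonneg _).trans (hKv 0 ⟨le_rfl, hT.le⟩ 0)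
  -- continuity in `x` of the tested fields
  have hGc : ∀ n t, Continuous (Gn n t) := fun n t =>
    ((hΨ.timeDeriv.isSmooth_slice t).continuous.add
      ((hb.smooth t).convect (isSmooth_fourierTruncate (φ n) (Ψ t))).continuous).add
      (isSmooth_viscAdj (majorTranspose 𝔸) (hΨ.isSmooth_slice t)).continuous
  have hgc : ∀ t, Continuous (g t) := fun t =>
    ((hΨ.timeDeriv.isSmooth_slice t).continuous.add ((hb.smooth t).convect (hΨ.isSmooth_slice t)).continuous).add
      (isSmooth_viscAdj (majorTranspose 𝔸) (hΨ.isSmooth_slice t)).continuous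
  -- pointwise truncation error and sup bounds of the tested fields, `t ∈ [0, T]`
  have hGg : ∀ n, ∀ t ∈ Icc 0 T, ∀ x, ‖Gn n t x - g t x‖ ≤ M * (K₃ * τ (φ n)) := by
    intro n t ht x
    have e : Gn n t x - g t x = FunctionSpaces.Torus.convect (b t) (fourierTruncate (φ n) (Ψ t)) x -
        FunctionSpaces.Torus.convect (b t) (Ψ t) x := by
      simp only [hGn, hg]; abel
    rw [e]
    exact (norm_convect_fourierTruncate_sub_le (hΨ.isSmooth_slice t) _ x).trans
      (mul_le_mul (hbx t x) (hK₃ _ t ht x) (Finset.sum_nonneg fun i _ => norm_nonneg _) hM0)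
  have hgx : ∀ t ∈ Icc 0 T, ∀ x, ‖g t x‖ ≤ Kp + M * Cd + Kv := by
    intro t ht x
    have h1 := hKp t ht x
    have h2 : ‖FunctionSpaces.Torus.convect (b t) (Ψ t) x‖ ≤ M * Cd :=
      (norm_convect_le (b t) ((hΨ.isSmooth_slice t).isContDiff (by simp)) x).trans
        (mul_le_mul (hbx t x) (hCd t ht x) (Finset.sum_nonneg fun i _ => norm_nonneg _) hM0)
    have h3 : ‖viscAdj (majorTranspose 𝔸) (Ψ t) x‖ ≤ Kv := hKv t ht x
    calc ‖g t x‖ ≤ ‖FunctionSpaces.Torus.timeDeriv Ψ t x + FunctionSpaces.Torus.convect (b t) (Ψ t) x‖ +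
          ‖viscAdj (majorTranspose 𝔸) (Ψ t) x‖ := norm_add_le _ _
      _ ≤ (‖FunctionSpaces.Torus.timeDeriv Ψ t x‖ + ‖FunctionSpaces.Torus.convect (b t) (Ψ t) x‖) +
          ‖viscAdj (majorTranspose 𝔸) (Ψ t) x‖ := by
          gcongr; exact norm_add_le _ _
      _ ≤ Kp + M * Cd + Kv := by linarith
  -- Step 3: pointwise convergence of the tested terms on `[0, T]`
  have hlim : ∀ t ∈ Icc 0 T, Tendsto (fun n => Fn n t) atTop (𝓝 (Fl t)) := by
    intro t ht
    have h1 : Tendsto (fun n => ∫ x, ⟪u n t x, g t x⟫_ℝ) atTop (𝓝 (Fl t)) := by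
      have hw := (hl.slice_props ht.1).2 (g t)
        ((hgc t).memLp_of_hasCompactSupport (HasCompactSupport.of_compactSpace _))
      have e2 : ∫ x, ⟪g t x, w t x⟫_ℝ = Fl t := integral_congr_ae (ae_of_all _ fun x => real_inner_comm _ _)
      rw [e2] at hw
      exact hw.congr fun n => integral_congr_ae (ae_of_all _ fun x => real_inner_comm _ _)
    have h2 : Tendsto (fun n => Fn n t - ∫ x, ⟪u n t x, g t x⟫_ℝ) atTop (𝓝 0) := by
      have hbd : ∀ n, |Fn n t - ∫ x, ⟪u n t x, g t x⟫_ℝ| ≤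
          M * (K₃ * τ (φ n)) / 2 * E + M * (K₃ * τ (φ n)) / 2 := by
        intro n
        have i1 : Integrable (fun x => ⟪u n t x, Gn n t x⟫_ℝ) volume :=
          integrable_inner_of_continuous ((hum n t).integrable one_le_two) (hGc n t)
        have i2 : Integrable (fun x => ⟪u n t x, g t x⟫_ℝ) volume :=
          integrable_inner_of_continuous ((hum n t).integrable one_le_two) (hgc t)
        have e : Fn n t - ∫ x, ⟪u n t x, g t x⟫_ℝ = ∫ x, ⟪u n t x, Gn n t x - g t x⟫_ℝ := by
          simp only [hFn]
          rw [← integral_sub i1 i2]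
          exact integral_congr_ae (ae_of_all _ fun x => by
            show ⟪u n t x, Gn n t x⟫_ℝ - ⟪u n t x, g t x⟫_ℝ = ⟪u n t x, Gn n t x - g t x⟫_ℝ
            rw [inner_sub_right])
        rw [e]
        have hL0 : 0 ≤ M * (K₃ * τ (φ n)) := mul_nonneg hM0 (mul_nonneg hK₃0 (hτnn _))
        refine (abs_integral_inner_le_half_of_norm_le' (hum n t) hL0 (hGg n t ht)).trans ?_
        have := mul_le_mul_of_nonneg_left (huE n t ht.1) (by positivity : 0 ≤ M * (K₃ * τ (φ n)) / 2)
        linarith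
      have h0 : Tendsto (fun n => M * (K₃ * τ (φ n)) / 2 * E + M * (K₃ * τ (φ n)) / 2) atTop (𝓝 0) := by
        have h3 : Tendsto (fun n => M * (K₃ * τ (φ n)) / 2) atTop (𝓝 (M * (K₃ * 0) / 2)) :=
          ((hτφ.const_mul K₃).const_mul M).div_const 2
        rw [mul_zero, mul_zero, zero_div] at h3
        have := (h3.mul_const E).add h3
        simpa using this
      exact squeeze_zero_norm (fun n => by rw [Real.norm_eq_abs]; exact hbd n) h0
    have := h1.add h2
    rw [add_zero] at this
    exact this.congr fun n => by ring
  -- Step 4: uniform bound of the tested terms, eventually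
  have hτ1 : ∀ᶠ n in atTop, τ (φ n) ≤ 1 := ((tendsto_order.1 hτφ).2 1 one_pos).mono fun n hn => hn.le
  set K : ℝ := (Kp + M * Cd + Kv + M * K₃) / 2 * E + (Kp + M * Cd + Kv + M * K₃) / 2 with hK
  have hbound : ∀ᶠ n in atTop, ∀ t ∈ Icc 0 T, |Fn n t| ≤ K := by
    filter_upwards [hτ1] with n hn t ht
    have hL0 : 0 ≤ Kp + M * Cd + Kv + M * K₃ := by positivity
    have hGx : ∀ x, ‖Gn n t x‖ ≤ Kp + M * Cd + Kv + M * K₃ := by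
      intro x
      have h4 : M * (K₃ * τ (φ n)) ≤ M * K₃ := by
        have := mul_le_mul_of_nonneg_left hn hK₃0
        rw [mul_one] at this
        exact mul_le_mul_of_nonneg_left this hM0
      calc ‖Gn n t x‖ = ‖g t x + (Gn n t x - g t x)‖ := by rw [add_sub_cancel]
        _ ≤ ‖g t x‖ + ‖Gn n t x - g t x‖ := norm_add_le _ _
        _ ≤ (Kp + M * Cd + Kv) + M * (K₃ * τ (φ n)) := add_le_add (hgx t ht x) (hGg n t ht x)
        _ ≤ Kp + M * Cd + Kv + M * K₃ := by linarith
    refine (abs_integral_inner_le_half_of_norm_le' (hum n t) hL0 hGx).trans ?_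
    have := mul_le_mul_of_nonneg_left (huE n t ht.1) (by positivity : 0 ≤ (Kp + M * Cd + Kv + M * K₃) / 2)
    simp only [hK]
    linarith
  -- Step 5: dominated convergence on `(0, T)`
  have hDCT : Tendsto (fun n => ∫ t in Ioo 0 T, Fn n t) atTop (𝓝 (∫ t in Ioo 0 T, Fl t)) := by
    refine tendsto_integral_filter_of_dominated_convergence (fun _ => K) ?_ ?_ ?_ ?_
    · exact Eventually.of_forall fun n =>
        ((h.continuousOn_galerkinTested hΨ (majorTranspose 𝔸) (φ n)).mono
          fun t ht => (le_of_lt (ht : t ∈ Ioo 0 T).1 : t ∈ Ici 0)).aestronglyMeasurable measurableSet_Ioo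
    · filter_upwards [hbound] with n hn
      rw [ae_restrict_iff' measurableSet_Ioo]
      exact ae_of_all _ fun t ht => by rw [Real.norm_eq_abs]; exact hn t (Ioo_subset_Icc_self ht)
    · exact integrableOn_const measure_Ioo_lt_top.ne
    · rw [ae_restrict_iff' measurableSet_Ioo]
      exact ae_of_all _ fun t ht => hlim t (Ioo_subset_Icc_self ht)
  -- Step 6: the datum term and the conclusion
  have hdat := tendsto_integral_inner_fourierTruncate_left_subseq h.memLp ((hΨ.isSmooth_slice 0).memLp 2) hl.strictMono
  have hsum := hDCT.add hdat
  exact tendsto_nhds_unique_of_eventuallyEq hsum tendsto_const_nhds hID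

end WeakForm

/-! ## The weak solution -/

section Solution

variable {𝔸 : Visc4 d} {lo hi : ℝ} {b : ℝ → UnitAddTorus d → EuclideanSpace ℝ d} {M G : ℝ}
  {w₀ : UnitAddTorus d → EuclideanSpace ℝ d}
  {h : PVSSetup 𝔸 lo hi b M G w₀} {φ : ℕ → ℕ} {c : ℝ → (d → ℤ) → EuclideanSpace ℂ d}
  {w : ℝ → UnitAddTorus d → EuclideanSpace ℝ d}

/-- **Bookkeeping of a Galerkin limit for the weak class** on `(0,T)`: joint measurability of `w` on `(0,T) × ℝ^d`,
the `L^∞_t L²_x` bound `∫⁻‖w t‖ₑ² ≤ ∫‖w₀‖²` for a.e. `t ∈ (0,T)`, and `‖b‖‖w‖ ∈ L¹((0,T) × T^d)` (bounded carrier,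
`L² ⊆ L¹` on the probability space `T^d`). [cite: DiPernaLions1989, §II.1 (12)–(14)] -/
theorem PVSSetup.IsGalerkinLimit.bookkeeping (hl : h.IsGalerkinLimit φ c w) (T : ℝ) :
    AEStronglyMeasurable (stLift w) (volume.restrict (Ioo 0 T ×ˢ (univ : Set (EuclideanSpace ℝ d)))) ∧
      (∀ᵐ t ∂(volume.restrict (Ioo 0 T)), ∫⁻ x, ‖w t x‖ₑ ^ 2 ≤ (Real.toNNReal (∫ x, ‖w₀ x‖ ^ 2) : ℝ≥0∞)) ∧
      ∫⁻ t in Ioo 0 T, ∫⁻ x, ‖b t x‖ₑ * ‖w t x‖ₑ < ∞ := by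
  have hb := h.carrier
  refine ⟨hl.aestronglyMeasurable.mono_measure
    (Measure.restrict_mono (prod_mono Ioo_subset_Ioi_self subset_rfl) le_rfl), ?_, ?_⟩
  · filter_upwards [ae_restrict_mem measurableSet_Ioo] with t ht
    rw [lintegral_enorm_sq_eq_ofReal (hl.memLp t ht.1.le), ENNReal.ofNNReal_toNNReal]
    exact ENNReal.ofReal_le_ofReal (hl.integral_norm_sq_le ht.1.le)
  · -- `∫⁻‖w t‖ₑ ≤ √E` for `t ≥ 0`
    have hL1 : ∀ t, 0 ≤ t → ∫⁻ x, ‖w t x‖ₑ ≤ ENNReal.ofReal (Real.sqrt (∫ x, ‖w₀ x‖ ^ 2)) := by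
      intro t ht
      have hm := hl.memLp t ht
      calc ∫⁻ x, ‖w t x‖ₑ = eLpNorm (w t) 1 volume := by rw [eLpNorm_one_eq_lintegral_enorm]
        _ ≤ eLpNorm (w t) 2 volume := eLpNorm_le_eLpNorm_of_exponent_le (by norm_num) hm.1
        _ = (∫⁻ x, ‖w t x‖ₑ ^ 2) ^ (1 / (2 : ℝ)) := by
            rw [eLpNorm_eq_lintegral_rpow_enorm_toReal two_ne_zero ENNReal.ofNat_ne_top, ENNReal.toReal_ofNat]
            congr 1
            exact lintegral_congr fun x => by rw [← ENNReal.rpow_two]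
        _ ≤ ENNReal.ofReal (Real.sqrt (∫ x, ‖w₀ x‖ ^ 2)) := by
            have h0 : 0 ≤ ∫ x, ‖w t x‖ ^ 2 := integral_nonneg fun x => by positivity
            rw [lintegral_enorm_sq_eq_ofReal hm, ENNReal.ofReal_rpow_of_nonneg h0 (by norm_num : (0:ℝ) ≤ 1 / 2),
              Real.sqrt_eq_rpow]
            exact ENNReal.ofReal_le_ofReal (Real.rpow_le_rpow h0 (hl.integral_norm_sq_le ht) (by norm_num))
    set K : ℝ≥0∞ := ENNReal.ofReal M * ENNReal.ofReal (Real.sqrt (∫ x, ‖w₀ x‖ ^ 2)) with hK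
    have hbd : ∀ t, 0 ≤ t → ∫⁻ x, ‖b t x‖ₑ * ‖w t x‖ₑ ≤ K := by
      intro t ht
      calc ∫⁻ x, ‖b t x‖ₑ * ‖w t x‖ₑ ≤ ∫⁻ x, ENNReal.ofReal M * ‖w t x‖ₑ :=
            lintegral_mono fun x => by
              have hbx : ‖b t x‖ₑ ≤ ENNReal.ofReal M := by
                rw [← ofReal_norm]
                exact ENNReal.ofReal_le_ofReal (hb.norm_le t x)
              gcongr
        _ = ENNReal.ofReal M * ∫⁻ x, ‖w t x‖ₑ := lintegral_const_mul' _ _ ENNReal.ofReal_ne_top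
        _ ≤ K := by
            rw [hK]
            gcongr
            exact hL1 t ht
    calc ∫⁻ t in Ioo 0 T, ∫⁻ x, ‖b t x‖ₑ * ‖w t x‖ₑ ≤ ∫⁻ _ in Ioo 0 T, K :=
          lintegral_mono_ae (by
            filter_upwards [ae_restrict_mem measurableSet_Ioo] with t ht
            exact hbd t ht.1.le)
      _ < ∞ := by
          rw [setLIntegral_const]
          exact ENNReal.mul_lt_top (ENNReal.mul_lt_top ENNReal.ofReal_lt_top ENNReal.ofReal_lt_top) measure_Ioo_lt_top

/-- **A Galerkin limit of the smooth-carrier scheme at tensor `𝔸` is a weak solution of the tensor passive-vector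
equation with tensor `𝔸ᵀ`** on `[0, T)` for every `T > 0`, in the class `Torus.IsWeakTensorPassiveVectorOn 0 T 𝔸ᵀ b w₀ w`
(Frisch 1995 (9.57); the Galerkin field carries the adjoint symbol, whence the transpose; bookkeeping
`IsGalerkinLimit.bookkeeping`, weak formulation `IsGalerkinLimit.weak_eq`). [cite: RobinsonRodrigoSadowski2016, Thm. 4.4] -/
theorem PVSSetup.IsGalerkinLimit.isWeakTensorPassiveVectorOn (hl : h.IsGalerkinLimit φ c w) {T : ℝ} (hT : 0 < T) :
    IsWeakTensorPassiveVectorOn 0 T (majorTranspose 𝔸) b w₀ w where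
  aestronglyMeasurable := (hl.bookkeeping T).1
  aestronglyMeasurable_carrier := (h.carrier.memLp_top_stLift T).1
  ae_lintegral_sq_le := ⟨_, (hl.bookkeeping T).2.1⟩
  lintegral_carrier_lt_top := h.carrier.lintegral_carrier_lt_top T
  lintegral_mul_lt_top := (hl.bookkeeping T).2.2
  ae_isWeaklyDivFree_carrier := ae_of_all _ fun t => h.carrier.isWeaklyDivFree t
  ae_isWeaklyDivFree := by
    filter_upwards [ae_restrict_mem measurableSet_Ioo] with t ht
    exact (hl.slice_props ht.1.le).1
  weak_eq := fun _ hΨ hΨdiv => hl.weak_eq hT hΨ hΨdiv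

/-- **Existence of weak solutions by the Fourier–Galerkin method with a smooth carrier** (Robinson–Rodrigo–Sadowski 2016,
Thm. 4.4, for Frisch's tensor passive-vector equation (9.57)): for the data `PVSSetup 𝔸 lo hi b M G w₀` there is a
Galerkin limit `w` — a weak solution `IsWeakTensorPassiveVectorOn 0 T 𝔸ᵀ b w₀ w` for every `T > 0` — whose slices for
`t ≥ 0` lie in `L²` with `∫‖w t‖² ≤ ∫‖w₀‖²`. [cite: RobinsonRodrigoSadowski2016, Thm. 4.4] -/
theorem PVSSetup.exists_weak_solution (h : PVSSetup 𝔸 lo hi b M G w₀) :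
    ∃ (φ : ℕ → ℕ) (c : ℝ → (d → ℤ) → EuclideanSpace ℂ d) (w : ℝ → UnitAddTorus d → EuclideanSpace ℝ d),
      h.IsGalerkinLimit φ c w ∧
      (∀ T, 0 < T → IsWeakTensorPassiveVectorOn 0 T (majorTranspose 𝔸) b w₀ w) ∧
      (∀ t, 0 ≤ t → MemLp (w t) 2 volume) ∧
      ∀ t, 0 ≤ t → ∫ x, ‖w t x‖ ^ 2 ≤ ∫ x, ‖w₀ x‖ ^ 2 := by
  obtain ⟨φ, c, w, hl⟩ := h.exists_isGalerkinLimit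
  exact ⟨φ, c, w, hl, fun T hT => hl.isWeakTensorPassiveVectorOn hT, hl.memLp, fun t ht => hl.integral_norm_sq_le ht⟩

end Solution

end Torus

end Literature.Analysis.FluidPDE
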